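import Literature.Probability.LatticeModels.DiscreteDualRectangle
import Literature.Probability.LatticeModels.DiscreteExtremalLengthExternalArcsSelfDual
import HarnessLib

/-!
# The extremal length of the interior dual rectangle is controlled by that of the rectangle (CDH16 (3.8))

Topic `Literature/Probability/LatticeModels` (family `crit-ising`); support for the printed proof of CDH16 Thm. 1.1
(`fkIsing_topologicalRectangle_crossingBounds`), §4: both in the free case (Cor. 4.4: `Z_{Ω*_int}` is bounded below
once `ℓ_{Ω*}[(a* b*),(c* d*)] ≲ ℓ_Ω̄ ≤ L`) and in the wired case (duality `Ω ↔ Ω*`, then part (i) in `Ω*`) the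
printed proof uses the comparison (3.8) `ℓ_{Ω*} ≍ ℓ_Ω̄` of the discrete extremal lengths of the completed interior
dual `Ω̄*` and of `Ω̄`, in the direction `ℓ_{Ω*} ≲ ℓ_Ω̄`. The source derives (3.8) from the comparison with continuous
extremal lengths (Chelkak 2016, Prop. 6.2). Here it is PROVED discretely, for rectangles on face domains without
pinch points presented by `IsRect.dual` (`DiscreteDualRectangle.lean`), from two ingredients already in the tree:

1. **exact planar duality up to a factor `4`** (`IsRect.le_extResistance_mul_extResistance_dual`):
   `ℓ_Ω̄[(a_ext b_ext),(c_ext d_ext)] · ℓ_{Ω̄*}[(b* c*),(d* a*)] ≥ 1/4` — the energy minimiser `u` of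
   `DiscreteExtremalLengthExternalArcsSelfDual.lean` for `(A_ext, C_ext)` has energy `I = 𝒞(A_ext ↔ C_ext)`; its
   harmonic conjugate `κ` on the squares (`IsRect.exists_conjugate`) read on the faces of `Ω` (the vertices of
   `Ω*_int`), together with the boundary-position values `ψ` (`psi`) read on the external dual vertices, is the
   dual test function `IsRect.dualFun`; its jumps across interior and pendant dual edges are primal currents
   (`IsRect.valL_sub_valR`), so its energy on `Ω̄*` is `≤ 4 I` (`IsRect.dirE_dualFun_le`), and it is `-I` on
   `B*_ext`, `0` on `D*_ext` (`psi_eq_of_B`, `IsRect.psi_eq_zero_of_D`); hence `𝒞_{Ω̄*}(B* ↔ D*) ≤ 4 / I`;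
2. **self-duality on the dual rectangle** (`IsRect.extResistance_mul_extResistance_le` of `DiscreteRectStokesBound`,
   `≤ 5476`, applied to `IsRect.dual`).

Main statements: `IsRect.extResistance_dual_le` — `ℓ_{Ω̄*}[(a* b*),(c* d*)] ≤ 21904 · ℓ_Ω̄[(a_ext b_ext),(c_ext d_ext)]`,
and, through the rotation of the marking (`IsRect.rotate`, `extArc_rotate`, `extArc_dual_rotate`),
`IsRect.extResistance_dual_one_three_le` — the same for the conjugate pair of arcs `(b c), (d a)`.
Everything is proved; no named fact is introduced.

## References
* [ChelkakDuminilCopinHongler2016] D. Chelkak, H. Duminil-Copin, C. Hongler, EJP 21 (2016) no. 5, §3.3, (3.8).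
* [Chelkak2016] D. Chelkak, *Robust discrete complex analysis: a toolbox*, Ann. Probab. 44 (2016), Prop. 6.2,
  Remark 6.5 (harmonic conjugate).
-/

noncomputable section

open scoped ENNReal
open SimpleGraph Finset

namespace Literature.Probability.LatticeModels

namespace DiscreteRect

variable {E : Finset (Sym2 (Site 2))}

/-! ### Comparison of the extremal lengths of `Ω̄*` and `Ω̄` (CDH16 (3.8), the direction used in §4) -/

section DualComparison

variable {d₀ : Site 2 × Fin 4} {n : Fin 4 → ℕ}
variable {u : Site 2 ⊕ (Site 2 × Fin 4) → ℝ} {κ : Site 2 → ℝ}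

/-- **The primal arrow of a dual dart** (inverse of `dualDart`): the dual dart `(g, k)` based at the square `g`
and pointing to `g + e_k` crosses the side of `g` from its corner `k + 1`, in direction `e_{k+1}`. [folklore] -/
def primalArrow (e : Site 2 × Fin 4) : Site 2 × Fin 4 :=
  (corner e.1 (e.2 + 1), e.2 + 1)

/-- `primalArrow` is a left inverse of `dualDart`. [folklore] -/
@[simp] theorem primalArrow_dualDart (a : Site 2 × Fin 4) : primalArrow (dualDart a) = a := by
  obtain ⟨p, m⟩ := a
  have k4 : ∀ k : Fin 4, k + 3 + 1 = k := by decide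
  simp [primalArrow, dualDart, k4]

/-- `primalArrow` is a right inverse of `dualDart`. [folklore] -/
@[simp] theorem dualDart_primalArrow (e : Site 2 × Fin 4) : dualDart (primalArrow e) = e := by
  obtain ⟨g, k⟩ := e
  have k4 : ∀ k : Fin 4, k + 1 + 3 = k := by decide
  simp [primalArrow, dualDart, k4]

/-- The left square of the primal arrow of `(g, k)` is `g`. [folklore] -/
@[simp] theorem lsq_primalArrow (e : Site 2 × Fin 4) : lsq (primalArrow e) = e.1 := by
  simp [primalArrow]

/-- The right square of the primal arrow of `(g, k)` is `g + e_k`. [folklore] -/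
theorem rsq_primalArrow (e : Site 2 × Fin 4) : rsq (primalArrow e) = e.1 + dir e.2 := by
  obtain ⟨g, k⟩ := e
  have k4 : ∀ k : Fin 4, k + 1 + 3 = k := by decide
  rw [primalArrow, rsq_mk, ← quad_add_dir_add_three, quad_corner, k4]

/-- The primal arrow of a dual dart based at a face is an edge of `E`. [folklore] -/
theorem aedge_primalArrow_mem {e : Site 2 × Fin 4} (h : InF E e.1) : aedge (primalArrow e) ∈ E :=
  h.side_mem (e.2 + 1)

/-- **The dual test function** built from a potential `u` on `Ω̄` and its harmonic conjugate `κ` on the squares: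
`κ` on the faces of `Ω` (the vertices of `Ω*_int`), and on the external dual vertex across a boundary arrow the value
`ψ` of the boundary position walking that arrow (the conjugate on the exterior side). [folklore] -/
def IsRect.dualFun (hR : IsRect E d₀ n) (κ : Site 2 → ℝ) (u : Site 2 ⊕ (Site 2 × Fin 4) → ℝ) :
    Site 2 ⊕ (Site 2 × Fin 4) → ℝ
  | .inl f => κ f
  | .inr e => psi E d₀ u (hR.idx (gen E (primalArrow e)))

/-- **Interior dual edges carry the primal current**: across a dual edge between two faces the conjugate jumps by
the current of the primal edge it crosses. [folklore] -/
theorem IsRect.sqIncr_kappa_of_faces (hR : IsRect E d₀ n) (hκ : ∀ b, κ (lsq b) - κ (rsq b) = zeta E d₀ n u b)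
    {f : Site 2} {k : Fin 4} (hf : InF E f) (hfk : InF E (f + dir k)) :
    sqIncr κ s(f, f + dir k) = dA u (primalArrow (f, k)) ^ 2 := by
  have hb : aedge (primalArrow (f, k)) ∈ E := aedge_primalArrow_mem hf
  have h := hκ (primalArrow (f, k))
  rw [hR.zeta_eq u hb, lsq_primalArrow, rsq_primalArrow] at h
  dsimp only at h
  rw [if_pos hfk, if_pos hf] at h
  rw [sqIncr_mk, h]
  ring

/-- **The interior dual energy is at most the primal edge energy** (twice, counting arrows). [folklore] -/
theorem IsRect.sum_dualInt_sqIncr_le (hR : IsRect E d₀ n) (hκ : ∀ b, κ (lsq b) - κ (rsq b) = zeta E d₀ n u b) :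
    ∑ e ∈ dualInt E, sqIncr κ e ≤ 2 * ∑ e ∈ E, sqIncr (u ∘ Sum.inl) e := by
  classical
  set P := ((faces E ×ˢ (Finset.univ : Finset (Fin 4))).filter fun p ↦ p.1 + dir p.2 ∈ faces E) with hP
  have h1 : ∑ e ∈ dualInt E, sqIncr κ e ≤ ∑ p ∈ P, sqIncr κ s(p.1, p.1 + dir p.2) := by
    have : dualInt E = P.image fun p ↦ s(p.1, p.1 + dir p.2) := by
      unfold dualInt; rw [hP]
    rw [this]
    exact Finset.sum_image_le_of_nonneg fun e _ ↦ sqIncr_nonneg _ _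
  have h2 : ∑ p ∈ P, sqIncr κ s(p.1, p.1 + dir p.2) = ∑ p ∈ P, dA u (primalArrow p) ^ 2 :=
    Finset.sum_congr rfl fun p hp ↦ by
      obtain ⟨hp1, hp2⟩ := Finset.mem_filter.1 hp
      exact hR.sqIncr_kappa_of_faces hκ (mem_faces.1 (Finset.mem_product.1 hp1).1) (mem_faces.1 hp2)
  have hinj : Set.InjOn primalArrow ↑P := fun p _ q _ h ↦ by
    simpa using congrArg dualDart h
  have h3 : ∑ p ∈ P, dA u (primalArrow p) ^ 2 = ∑ b ∈ P.image primalArrow, dA u b ^ 2 :=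
    (Finset.sum_image (f := fun b ↦ dA u b ^ 2) hinj).symm
  have h4 : P.image primalArrow ⊆ arrows E := by
    intro b hb
    obtain ⟨p, hp, rfl⟩ := Finset.mem_image.1 hb
    exact mem_arrows.2 (aedge_primalArrow_mem (mem_faces.1 (Finset.mem_product.1 (Finset.mem_filter.1 hp).1).1))
  calc ∑ e ∈ dualInt E, sqIncr κ e ≤ _ := h1
    _ = _ := h2
    _ = _ := h3
    _ ≤ ∑ b ∈ arrows E, dA u b ^ 2 := Finset.sum_le_sum_of_subset_of_nonneg h4 fun _ _ _ ↦ sq_nonneg _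
    _ = _ := sum_arrows_dA_sq_eq hR.subset_edgeSet u

/-- **Pendant dual edges carry the boundary current**: across the pendant dual edge of a boundary arrow the dual
test function jumps by the (tangential) current of that arrow. [folklore] -/
theorem IsRect.dP_dualFun_dualDart (hR : IsRect E d₀ n) (hκ : ∀ b, κ (lsq b) - κ (rsq b) = zeta E d₀ n u b)
    (hκ0 : ∀ i, κ (quad ((succ E)^[i] d₀).1 ((succ E)^[i] d₀).2) = 0) {a : Site 2 × Fin 4}
    (hb : aedge a ∈ E) (hl : InF E (lsq a)) (hr : ¬ InF E (rsq a)) :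
    dP (hR.dualFun κ u) (dualDart a) = -dA u a := by
  have h := hR.valL_sub_valR hκ hκ0 hb
  rw [if_pos hl, if_neg hr] at h
  show hR.dualFun κ u (.inl (dualDart a).1) - hR.dualFun κ u (.inr (dualDart a)) = -dA u a
  simp only [IsRect.dualFun, primalArrow_dualDart]
  exact h

/-- **The pendant dual energy is at most the primal edge energy** (twice). [folklore] -/
theorem IsRect.sum_dP_dualFun_le (hR : IsRect E d₀ n) (hF : IsFaceDomain E) (hP : ∀ q, NoPinchAt E q)
    (hiso : ∀ f ∈ faces E, f ∈ verts (dualInt E)) (hpos : ∀ j, 0 < dualCount E d₀ n j)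
    (hκ : ∀ b, κ (lsq b) - κ (rsq b) = zeta E d₀ n u b)
    (hκ0 : ∀ i, κ (quad ((succ E)^[i] d₀).1 ((succ E)^[i] d₀).2) = 0) :
    ∑ t ∈ range (dualCount E d₀ n 0 + dualCount E d₀ n 1 + dualCount E d₀ n 2 + dualCount E d₀ n 3),
        dP (hR.dualFun κ u) ((succ (dualInt E))^[t] (dualDart (firstArrow E d₀))) ^ 2 ≤
      2 * ∑ e ∈ E, sqIncr (u ∘ Sum.inl) e := by
  classical
  have hRd := hR.dual hF hP hiso hpos
  set M := dualCount E d₀ n 0 + dualCount E d₀ n 1 + dualCount E d₀ n 2 + dualCount E d₀ n 3 with hM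
  have hMlen : M = (walkedList E d₀ (n 0 + n 1 + n 2 + n 3)).length := sum_dualCount d₀ n
  have h1 : ∀ t ∈ range M, dP (hR.dualFun κ u) ((succ (dualInt E))^[t] (dualDart (firstArrow E d₀))) ^ 2 =
      dA u (primalArrow ((succ (dualInt E))^[t] (dualDart (firstArrow E d₀)))) ^ 2 := by
    intro t ht
    have ht' : t < (walkedList E d₀ (n 0 + n 1 + n 2 + n 3)).length := hMlen ▸ mem_range.1 ht
    rw [hR.iterate_succ_dualInt hF hP ht', primalArrow_dualDart]
    obtain ⟨hb, hr⟩ := aedge_mem_of_mem_walkedList hR.isExtDart (List.getElem_mem ht')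
    rw [hR.dP_dualFun_dualDart hκ hκ0 hb ((hF _ hb).resolve_right hr) hr, neg_sq]
  rw [Finset.sum_congr rfl h1]
  have hinj : Set.InjOn (fun t ↦ primalArrow ((succ (dualInt E))^[t] (dualDart (firstArrow E d₀)))) ↑(range M) := by
    intro t ht t' ht' h
    have h' := congrArg dualDart h
    simp only [dualDart_primalArrow] at h'
    exact hRd.injOn t t' (mem_range.1 ht) (mem_range.1 ht') h'
  rw [← Finset.sum_image (f := fun b ↦ dA u b ^ 2) hinj]
  have hsub : (range M).image (fun t ↦ primalArrow ((succ (dualInt E))^[t] (dualDart (firstArrow E d₀)))) ⊆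
      arrows E := by
    intro b hb
    obtain ⟨t, ht, rfl⟩ := Finset.mem_image.1 hb
    have ht' : t < (walkedList E d₀ (n 0 + n 1 + n 2 + n 3)).length := hMlen ▸ mem_range.1 ht
    rw [hR.iterate_succ_dualInt hF hP ht', primalArrow_dualDart]
    exact mem_arrows.2 (aedge_mem_of_mem_walkedList hR.isExtDart (List.getElem_mem ht')).1
  calc _ ≤ ∑ b ∈ arrows E, dA u b ^ 2 := Finset.sum_le_sum_of_subset_of_nonneg hsub fun _ _ _ ↦ sq_nonneg _
    _ = _ := sum_arrows_dA_sq_eq hR.subset_edgeSet u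

/-- **The energy of the dual test function** is at most four times the energy of `u`. [folklore] -/
theorem IsRect.dirE_dualFun_le (hR : IsRect E d₀ n) (hF : IsFaceDomain E) (hP : ∀ q, NoPinchAt E q)
    (hiso : ∀ f ∈ faces E, f ∈ verts (dualInt E)) (hpos : ∀ j, 0 < dualCount E d₀ n j)
    (hκ : ∀ b, κ (lsq b) - κ (rsq b) = zeta E d₀ n u b)
    (hκ0 : ∀ i, κ (quad ((succ E)^[i] d₀).1 ((succ E)^[i] d₀).2) = 0) :
    dirE (dualInt E) (dualDart (firstArrow E d₀)) (dualCount E d₀ n) (hR.dualFun κ u) ≤ 4 * dirE E d₀ n u := by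
  have h1 := hR.sum_dualInt_sqIncr_le hκ
  have h2 := hR.sum_dP_dualFun_le hF hP hiso hpos hκ hκ0
  have h3 : ∑ e ∈ E, sqIncr (u ∘ Sum.inl) e ≤ dirE E d₀ n u :=
    le_add_of_nonneg_right (sum_nonneg fun _ _ ↦ sq_nonneg _)
  calc dirE (dualInt E) (dualDart (firstArrow E d₀)) (dualCount E d₀ n) (hR.dualFun κ u)
      = ∑ e ∈ dualInt E, sqIncr κ e + ∑ t ∈ range (dualCount E d₀ n 0 + dualCount E d₀ n 1 +
          dualCount E d₀ n 2 + dualCount E d₀ n 3),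
          dP (hR.dualFun κ u) ((succ (dualInt E))^[t] (dualDart (firstArrow E d₀))) ^ 2 := rfl
    _ ≤ 2 * ∑ e ∈ E, sqIncr (u ∘ Sum.inl) e + 2 * ∑ e ∈ E, sqIncr (u ∘ Sum.inl) e := add_le_add h1 h2
    _ ≤ 4 * dirE E d₀ n u := by linarith

/-- **Boundary values of the dual test function**: on the dual external arc `j` it takes the values `ψ_i` of the
positions `i` of arc `j`. [folklore] -/
theorem IsRect.dualFun_of_mem_extArc_dual (hR : IsRect E d₀ n) (hF : IsFaceDomain E) (hP : ∀ q, NoPinchAt E q)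
    {j : Fin 4} {v : Site 2 ⊕ (Site 2 × Fin 4)}
    (hv : v ∈ extArc (dualInt E) (dualDart (firstArrow E d₀)) (dualCount E d₀ n) j) :
    ∃ i, lo n j ≤ i ∧ i < lo n j + n j ∧ hR.dualFun κ u v = psi E d₀ u i := by
  rw [hR.extArc_dual hF hP j] at hv
  obtain ⟨i, h1, h2, a, ha, rfl⟩ := hv
  refine ⟨i, h1, h2, ?_⟩
  show psi E d₀ u (hR.idx (gen E (primalArrow (dualDart a)))) = psi E d₀ u i
  rw [primalArrow_dualDart, gen_eq_of_mem_slots (hR.isExtDart_iterate i).2 ha,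
    hR.idx_iterate (lt_of_lt_of_le h2 (lo_add_le n j))]

/-- **The extremal length of `Ω̄` and the conjugate extremal length of `Ω̄*` are dual up to a factor `4`**:
`ℓ_Ω̄[(a_ext b_ext),(c_ext d_ext)] · ℓ_{Ω̄*}[(b* c*),(d* a*)] ≥ 1/4` — the energy minimiser `u` for
`(A_ext, C_ext)` on `Ω̄` has energy `I = 𝒞(A_ext ↔ C_ext)`, and its harmonic conjugate (on the faces) together with
the boundary-position values (on the external dual vertices) is, after division by `-I`, a test function for
`(B*_ext, D*_ext)` on `Ω̄*` of energy `≤ 4/I`. (The exact planar duality would give `= 1`; the factor is lost in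
counting each primal current at most four times.) [cite: ChelkakDuminilCopinHongler2016, §3.3 (3.8)] -/
theorem IsRect.le_extResistance_mul_extResistance_dual (hR : IsRect E d₀ n) (hF : IsFaceDomain E)
    (hP : ∀ q, NoPinchAt E q) (hiso : ∀ f ∈ faces E, f ∈ verts (dualInt E))
    (hpos : ∀ j, 0 < dualCount E d₀ n j) :
    ENNReal.ofReal (1 / 4) ≤ extResistance E d₀ n 0 2 *
      extResistance (dualInt E) (dualDart (firstArrow E d₀)) (dualCount E d₀ n) 1 3 := by
  classical
  have hRd := hR.dual hF hP hiso hpos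
  obtain ⟨hl0, hl1, hl2, hl3⟩ := lo_eq n
  -- the minimiser for `(A_ext, C_ext)` and its harmonicity
  obtain ⟨u, huA, huC, hmin⟩ := hR.exists_dirE_min
  have hlap : ∀ x, lap E d₀ n u x = 0 := hR.lap_eq_zero_of_min huA huC hmin
  have hB : ∀ i, n 0 ≤ i → i < n 0 + n 1 → dP u ((succ E)^[i] d₀) = 0 := fun i h1 h2 ↦
    hR.dP_eq_zero_of_min huA huC hmin (Or.inl ⟨h1, h2⟩)
  have hD : ∀ i, n 0 + n 1 + n 2 ≤ i → i < n 0 + n 1 + n 2 + n 3 →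
      dP u ((succ E)^[i] d₀) = 0 := fun i h1 h2 ↦
    hR.dP_eq_zero_of_min huA huC hmin (Or.inr ⟨h1, h2⟩)
  have huA' : ∀ i < n 0, u (.inr ((succ E)^[i] d₀)) = 1 := fun i hi ↦
    huA ⟨i, by omega, by omega, rfl⟩
  have huC' : ∀ i, n 0 + n 1 ≤ i → i < n 0 + n 1 + n 2 → u (.inr ((succ E)^[i] d₀)) = 0 :=
    fun i h1 h2 ↦ huC ⟨i, by omega, by omega, rfl⟩
  -- its energy is the current `I` out of `A`, and `𝒞(A ↔ C) = I > 0`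
  have hIcur := hR.dirE_eq_current hlap hB hD huA' huC'
  have hC02 : effectiveConductance (extGraph E) 1 (extArc E d₀ n 0) (extArc E d₀ n 2) =
      ENNReal.ofReal (dirE E d₀ n u) :=
    le_antisymm ((effectiveConductance_le_networkEnergy huA huC).trans_eq (hR.networkEnergy_eq_dirE u))
      (le_effectiveConductance fun v hvA hvC ↦ by
        rw [hR.networkEnergy_eq_dirE]; exact ENNReal.ofReal_le_ofReal (hmin v hvA hvC))
  have hIpos : 0 < dirE E d₀ n u := by
    by_contra hle
    have h := hR.le_effectiveConductance_mul
    rw [hC02, ENNReal.ofReal_of_nonpos (not_lt.1 hle), zero_mul, nonpos_iff_eq_zero,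
      ENNReal.ofReal_eq_zero] at h
    norm_num at h
  -- the harmonic conjugate and the dual test function for `(B*_ext, D*_ext)`
  obtain ⟨κ, hκ, hκ0⟩ := hR.exists_conjugate hlap
  have hEw := hR.dirE_dualFun_le hF hP hiso hpos hκ hκ0 (u := u)
  have hwB : (extArc (dualInt E) (dualDart (firstArrow E d₀)) (dualCount E d₀ n) 1).EqOn
      (fun v ↦ (-(dirE E d₀ n u)⁻¹) * hR.dualFun κ u v) 1 := by
    intro v hv
    obtain ⟨i, h1, h2, hv⟩ := hR.dualFun_of_mem_extArc_dual hF hP hv (κ := κ) (u := u)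
    show (-(dirE E d₀ n u)⁻¹) * hR.dualFun κ u v = 1
    have hS : ∑ l ∈ range (n 0), dP u ((succ E)^[l] d₀) = -dirE E d₀ n u := by linarith
    rw [hv, psi_eq_of_B hB (by omega) (by omega), hS]
    field_simp
  have hwD : (extArc (dualInt E) (dualDart (firstArrow E d₀)) (dualCount E d₀ n) 3).EqOn
      (fun v ↦ (-(dirE E d₀ n u)⁻¹) * hR.dualFun κ u v) 0 := by
    intro v hv
    obtain ⟨i, h1, h2, hv⟩ := hR.dualFun_of_mem_extArc_dual hF hP hv (κ := κ) (u := u)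
    show (-(dirE E d₀ n u)⁻¹) * hR.dualFun κ u v = 0
    rw [hv, hR.psi_eq_zero_of_D hlap hD (by omega) (by omega), mul_zero]
  have hC13 : effectiveConductance (extGraph (dualInt E)) 1
      (extArc (dualInt E) (dualDart (firstArrow E d₀)) (dualCount E d₀ n) 1)
      (extArc (dualInt E) (dualDart (firstArrow E d₀)) (dualCount E d₀ n) 3) ≤
      ENNReal.ofReal (4 / dirE E d₀ n u) := by
    refine (effectiveConductance_le_networkEnergy hwB hwD).trans ?_
    rw [hRd.networkEnergy_eq_dirE, dirE_const_mul]
    refine ENNReal.ofReal_le_ofReal ?_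
    calc (-(dirE E d₀ n u)⁻¹) ^ 2 * dirE (dualInt E) (dualDart (firstArrow E d₀)) (dualCount E d₀ n)
          (hR.dualFun κ u)
        ≤ (-(dirE E d₀ n u)⁻¹) ^ 2 * (4 * dirE E d₀ n u) :=
          mul_le_mul_of_nonneg_left hEw (sq_nonneg _)
      _ = 4 / dirE E d₀ n u := by
          rw [neg_sq, inv_pow, inv_mul_eq_div, pow_two, mul_div_mul_right _ _ hIpos.ne']
  -- conclusion
  unfold extResistance effectiveResistance
  rw [hC02]
  have h4 : ENNReal.ofReal (1 / 4) =
      (ENNReal.ofReal (dirE E d₀ n u))⁻¹ * (ENNReal.ofReal (4 / dirE E d₀ n u))⁻¹ := by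
    rw [← ENNReal.mul_inv (Or.inr ENNReal.ofReal_ne_top) (Or.inl ENNReal.ofReal_ne_top),
      ← ENNReal.ofReal_mul hIpos.le, ← mul_div_assoc, mul_div_cancel_left₀ _ hIpos.ne',
      ← ENNReal.ofReal_inv_of_pos (by norm_num : (0 : ℝ) < 4), one_div]
  rw [h4]
  exact mul_le_mul' le_rfl (ENNReal.inv_le_inv.2 hC13)

/-- **CDH16 (3.8), the direction used in the proof of Thm. 1.1**: `ℓ_{Ω̄*}[(a* b*),(c* d*)] ≤ 21904 ·
ℓ_Ω̄[(a_ext b_ext),(c_ext d_ext)]` for the interior dual `Ω*_int` of a rectangle on a face domain without pinch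
points (every face having a neighbour face, every arc walking an arrow), presented by `IsRect.dual`. The printed
source states `≍` (for bridgeless `Ω`) and derives it from the comparison with continuous extremal lengths (Chelkak
2016, Prop. 6.2); here: the duality bound `le_extResistance_mul_extResistance_dual` and the self-duality upper
bound `IsRect.extResistance_mul_extResistance_le` (`≤ 5476`) applied to the dual rectangle.
[cite: ChelkakDuminilCopinHongler2016, §3.3 (3.8)] -/
theorem IsRect.extResistance_dual_le (hR : IsRect E d₀ n) (hF : IsFaceDomain E) (hP : ∀ q, NoPinchAt E q)
    (hiso : ∀ f ∈ faces E, f ∈ verts (dualInt E)) (hpos : ∀ j, 0 < dualCount E d₀ n j) :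
    extResistance (dualInt E) (dualDart (firstArrow E d₀)) (dualCount E d₀ n) 0 2 ≤
      ENNReal.ofReal (4 * 5476) * extResistance E d₀ n 0 2 := by
  have h1 := hR.le_extResistance_mul_extResistance_dual hF hP hiso hpos
  have h2 := (hR.dual hF hP hiso hpos).extResistance_mul_extResistance_le
  set a := extResistance E d₀ n 0 2
  set b := extResistance (dualInt E) (dualDart (firstArrow E d₀)) (dualCount E d₀ n) 1 3
  set c := extResistance (dualInt E) (dualDart (firstArrow E d₀)) (dualCount E d₀ n) 0 2
  have h4 : 1 ≤ ENNReal.ofReal 4 * (a * b) :=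
    calc (1 : ℝ≥0∞) = ENNReal.ofReal 4 * ENNReal.ofReal (1 / 4) := by
          rw [← ENNReal.ofReal_mul (by norm_num)]; norm_num
      _ ≤ ENNReal.ofReal 4 * (a * b) := mul_le_mul' le_rfl h1
  calc c = c * 1 := (mul_one c).symm
    _ ≤ c * (ENNReal.ofReal 4 * (a * b)) := mul_le_mul' le_rfl h4
    _ = ENNReal.ofReal 4 * a * (c * b) := by ring
    _ ≤ ENNReal.ofReal 4 * a * ENNReal.ofReal 5476 := mul_le_mul' le_rfl h2
    _ = ENNReal.ofReal (4 * 5476) * a := by rw [ENNReal.ofReal_mul (by norm_num)]; ring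

end DualComparison

/-! ### Rotating the marking of a rectangle by one arc -/

section Rotate

variable {d₀ : Site 2 × Fin 4} {n : Fin 4 → ℕ}

/-- The arc sizes of the rectangle marked from its second arc: `(n 1, n 2, n 3, n 0)`. [folklore] -/
def rotN (n : Fin 4 → ℕ) : Fin 4 → ℕ :=
  ![n 1, n 2, n 3, n 0]

/-- The rotated marking has the same period. [folklore] -/
theorem sum_rotN (n : Fin 4 → ℕ) : rotN n 0 + rotN n 1 + rotN n 2 + rotN n 3 = n 0 + n 1 + n 2 + n 3 := by
  simp [rotN]; omega

/-- **Rotating the marking** `(a, b, c, d) ↦ (b, c, d, a)`: the same rectangle, its boundary cycle started at the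
first dart of its second arc. [folklore] -/
theorem IsRect.rotate (hR : IsRect E d₀ n) : IsRect E ((succ E)^[n 0] d₀) (rotN n) where
  subset_edgeSet := hR.subset_edgeSet
  isExtDart := hR.isExtDart_iterate _
  pos j := by fin_cases j <;> simp [rotN] <;> exact hR.pos _
  periodic := by rw [sum_rotN, ← Function.iterate_add_apply, Nat.add_comm, hR.iterate_add_period]
  injOn i j hi hj hij := by
    rw [sum_rotN] at hi hj
    rw [← Function.iterate_add_apply, ← Function.iterate_add_apply] at hij
    obtain ⟨j', hj', hj'eq, hjj'⟩ : ∃ j' < n 0 + n 1 + n 2 + n 3, (succ E)^[j + n 0] d₀ = (succ E)^[j'] d₀ ∧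
        (j + n 0 = j' ∨ j + n 0 = j' + (n 0 + n 1 + n 2 + n 3)) := by
      by_cases h : j + n 0 < n 0 + n 1 + n 2 + n 3
      · exact ⟨j + n 0, h, rfl, Or.inl rfl⟩
      · refine ⟨j + n 0 - (n 0 + n 1 + n 2 + n 3), by omega, ?_, Or.inr (by omega)⟩
        conv_lhs => rw [show j + n 0 = (j + n 0 - (n 0 + n 1 + n 2 + n 3)) + (n 0 + n 1 + n 2 + n 3) by omega]
        exact hR.iterate_add_period _
    rw [hj'eq] at hij
    rcases hR.eq_or_eq_add_of_iterate_eq (by omega) hj' hij with h | h <;> omega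
  cover d hd := by
    obtain ⟨i, hi, rfl⟩ := hR.cover d hd
    rw [sum_rotN]
    by_cases h : n 0 ≤ i
    · refine ⟨i - n 0, by omega, ?_⟩
      rw [← Function.iterate_add_apply, Nat.sub_add_cancel h]
    · refine ⟨i + (n 0 + n 1 + n 2 + n 3) - n 0, by omega, ?_⟩
      rw [← Function.iterate_add_apply,
        show i + (n 0 + n 1 + n 2 + n 3) - n 0 + n 0 = i + (n 0 + n 1 + n 2 + n 3) by omega,
        hR.iterate_add_period]

/-- **Positions, rotated to original**: a position of arc `j` of the rotated marking carries the dart of a position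
of arc `j + 1` of the original marking. [folklore] -/
theorem IsRect.exists_pos_of_rotate (hR : IsRect E d₀ n) {j : Fin 4} {i : ℕ} (h1 : lo (rotN n) j ≤ i)
    (h2 : i < lo (rotN n) j + rotN n j) :
    ∃ i', lo n (j + 1) ≤ i' ∧ i' < lo n (j + 1) + n (j + 1) ∧
      (succ E)^[i] ((succ E)^[n 0] d₀) = (succ E)^[i'] d₀ := by
  rw [← Function.iterate_add_apply]
  fin_cases j <;> simp [lo, rotN] at h1 h2 ⊢
  · exact ⟨i + n 0, by omega, by omega, rfl⟩
  · exact ⟨i + n 0, by omega, by omega, rfl⟩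
  · exact ⟨i + n 0, by omega, by omega, rfl⟩
  · refine ⟨i + n 0 - (n 0 + n 1 + n 2 + n 3), by omega, ?_⟩
    conv_lhs => rw [show i + n 0 = (i + n 0 - (n 0 + n 1 + n 2 + n 3)) + (n 0 + n 1 + n 2 + n 3) by omega]
    exact hR.iterate_add_period _

/-- **Positions, original to rotated.** [folklore] -/
theorem IsRect.exists_pos_rotate (hR : IsRect E d₀ n) {j : Fin 4} {i' : ℕ} (h1 : lo n (j + 1) ≤ i')
    (h2 : i' < lo n (j + 1) + n (j + 1)) :
    ∃ i, lo (rotN n) j ≤ i ∧ i < lo (rotN n) j + rotN n j ∧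
      (succ E)^[i] ((succ E)^[n 0] d₀) = (succ E)^[i'] d₀ := by
  simp_rw [← Function.iterate_add_apply]
  fin_cases j <;> simp [lo, rotN] at h1 h2 ⊢
  · exact ⟨i' - n 0, by omega, by rw [Nat.sub_add_cancel h1]⟩
  · exact ⟨i' - n 0, by omega, by omega, by rw [Nat.sub_add_cancel (by omega)]⟩
  · exact ⟨i' - n 0, by omega, by omega, by rw [Nat.sub_add_cancel (by omega)]⟩
  · refine ⟨i' + (n 1 + n 2 + n 3), by omega, by omega, ?_⟩
    rw [show i' + (n 1 + n 2 + n 3) + n 0 = i' + (n 0 + n 1 + n 2 + n 3) by omega]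
    exact hR.iterate_add_period _

/-- The external arcs of the rotated marking. [folklore] -/
theorem IsRect.extArc_rotate (hR : IsRect E d₀ n) (j : Fin 4) :
    extArc E ((succ E)^[n 0] d₀) (rotN n) j = extArc E d₀ n (j + 1) := by
  ext v
  simp only [extArc, Set.mem_setOf_eq]
  constructor
  · rintro ⟨i, h1, h2, rfl⟩
    obtain ⟨i', h1', h2', he⟩ := hR.exists_pos_of_rotate h1 h2
    exact ⟨i', h1', h2', by rw [he]⟩
  · rintro ⟨i', h1', h2', rfl⟩
    obtain ⟨i, h1, h2, he⟩ := hR.exists_pos_rotate h1' h2'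
    exact ⟨i, h1, h2, by rw [he]⟩

/-- The vertex arcs of the rotated marking. [folklore] -/
theorem IsRect.arcVerts_rotate (hR : IsRect E d₀ n) (j : Fin 4) :
    arcVerts E ((succ E)^[n 0] d₀) (rotN n) j = arcVerts E d₀ n (j + 1) := by
  ext x
  simp only [arcVerts, Set.mem_setOf_eq]
  constructor
  · rintro ⟨i, h1, h2, rfl⟩
    obtain ⟨i', h1', h2', he⟩ := hR.exists_pos_of_rotate h1 h2
    exact ⟨i', h1', h2', by rw [he]⟩
  · rintro ⟨i', h1', h2', rfl⟩
    obtain ⟨i, h1, h2, he⟩ := hR.exists_pos_rotate h1' h2'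
    exact ⟨i, h1, h2, by rw [he]⟩

/-- The extremal lengths of the rotated marking. [folklore] -/
theorem IsRect.extResistance_rotate (hR : IsRect E d₀ n) (j j' : Fin 4) :
    extResistance E ((succ E)^[n 0] d₀) (rotN n) j j' = extResistance E d₀ n (j + 1) (j' + 1) := by
  unfold extResistance
  rw [hR.extArc_rotate, hR.extArc_rotate]

/-- The dual arc sizes of the rotated marking. [folklore] -/
theorem IsRect.dualCount_rotate (hR : IsRect E d₀ n) (j : Fin 4) :
    dualCount E ((succ E)^[n 0] d₀) (rotN n) j = dualCount E d₀ n (j + 1) := by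
  unfold dualCount
  rw [← Function.iterate_add_apply]
  have hper : (succ E)^[n 1 + n 2 + n 3 + n 0] d₀ = (succ E)^[0] d₀ := by
    rw [show n 1 + n 2 + n 3 + n 0 = 0 + (n 0 + n 1 + n 2 + n 3) by omega, hR.iterate_add_period]
  fin_cases j
  · simp [lo, rotN]
  · simp [lo, rotN, Nat.add_comm (n 1) (n 0)]
  · simp [lo, rotN, show n 1 + n 2 + n 0 = n 0 + n 1 + n 2 by omega]
  · simp [lo, rotN, hper]

/-- **The dual of the rotated marking is the rotated dual**: its external arcs are those of the dual presentation,
rotated. [folklore] -/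
theorem IsRect.extArc_dual_rotate (hR : IsRect E d₀ n) (hF : IsFaceDomain E) (hP : ∀ q, NoPinchAt E q) (j : Fin 4) :
    extArc (dualInt E) (dualDart (firstArrow E ((succ E)^[n 0] d₀))) (dualCount E ((succ E)^[n 0] d₀) (rotN n)) j =
      extArc (dualInt E) (dualDart (firstArrow E d₀)) (dualCount E d₀ n) (j + 1) := by
  rw [hR.rotate.extArc_dual hF hP j, hR.extArc_dual hF hP (j + 1)]
  ext v
  simp only [Set.mem_setOf_eq]
  constructor
  · rintro ⟨i, h1, h2, a, ha, rfl⟩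
    obtain ⟨i', h1', h2', he⟩ := hR.exists_pos_of_rotate h1 h2
    exact ⟨i', h1', h2', a, by rwa [← he], rfl⟩
  · rintro ⟨i', h1', h2', a, ha, rfl⟩
    obtain ⟨i, h1, h2, he⟩ := hR.exists_pos_rotate h1' h2'
    exact ⟨i, h1, h2, a, by rwa [he], rfl⟩

/-- The extremal lengths of the dual of the rotated marking. [folklore] -/
theorem IsRect.extResistance_dual_rotate (hR : IsRect E d₀ n) (hF : IsFaceDomain E) (hP : ∀ q, NoPinchAt E q)
    (j j' : Fin 4) :
    extResistance (dualInt E) (dualDart (firstArrow E ((succ E)^[n 0] d₀)))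
        (dualCount E ((succ E)^[n 0] d₀) (rotN n)) j j' =
      extResistance (dualInt E) (dualDart (firstArrow E d₀)) (dualCount E d₀ n) (j + 1) (j' + 1) := by
  unfold extResistance
  rw [hR.extArc_dual_rotate hF hP, hR.extArc_dual_rotate hF hP]

/-- **CDH16 (3.8) for the conjugate pair of arcs**: `ℓ_{Ω̄*}[(b* c*),(d* a*)] ≤ 21904 · ℓ_Ω̄[(b_ext c_ext),(d_ext a_ext)]`
(the bound `IsRect.extResistance_dual_le` for the rotated marking, read back on the original presentations).
[cite: ChelkakDuminilCopinHongler2016, §3.3 (3.8)] -/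
theorem IsRect.extResistance_dual_one_three_le (hR : IsRect E d₀ n) (hF : IsFaceDomain E)
    (hP : ∀ q, NoPinchAt E q) (hiso : ∀ f ∈ faces E, f ∈ verts (dualInt E))
    (hpos : ∀ j, 0 < dualCount E d₀ n j) :
    extResistance (dualInt E) (dualDart (firstArrow E d₀)) (dualCount E d₀ n) 1 3 ≤
      ENNReal.ofReal (4 * 5476) * extResistance E d₀ n 1 3 := by
  have hpos' : ∀ j, 0 < dualCount E ((succ E)^[n 0] d₀) (rotN n) j := fun j ↦ by
    rw [hR.dualCount_rotate]; exact hpos _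
  have h := hR.rotate.extResistance_dual_le hF hP hiso hpos'
  rwa [hR.extResistance_dual_rotate hF hP, hR.extResistance_rotate] at h

end Rotate

end DiscreteRect

end Literature.Probability.LatticeModels
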